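import Mathlib
import Literature.NumberTheory.GaloisRepresentations.GaloisRep
import Literature.NumberTheory.GaloisRepresentations.IntegralGaloisActionProofs
import Literature.NumberTheory.GaloisRepresentations.CubicResidueSymbol
import Literature.NumberTheory.Automorphic.ReciprocityGLn
import Literature.NumberTheory.Automorphic.HilbertPartialHasseWeightShiftingProofs
import HarnessLib

/-!
# Route `PicardMuOrdinary`, crux `MuOrdinaryFamilyRT` (stmt-Langlands-13757): stub 6 of the line
# `char-zero-dominance` — the dictionary to the typed `ℤ̄_𝔐`-congruence

This file proves STUB 6 (`stub_dictionary`) of the checked skeleton of the line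
`char-zero-dominance` for the crux
`Summit.Langlands.Langlands.Theses.PicardMuOrdinary.MuOrdinaryFamilyRT` (item `stmt-Langlands-13757`).
`S.stub_dictionary` below is VERBATIM the registered statement (declared in the skeleton's
namespace, with the skeleton-local `K = CyclotomicField 3 ℚ`).

**Proof.**  (1) *The place.* `𝔐 := {z ∈ ℤ̄ : ‖ι⁻¹ z‖ < 1}`: algebraic integers have `‖ι⁻¹ z‖ ≤ 1`
in the ultrametric field `ℚ̄₃` (valuation rings are integrally closed, Mathlib
`Valuation.Integers.isIntegral_iff_v_le_one`), so `𝔐` is a prime ideal `∋ 3`; it is maximal since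
`ℤ̄ / ℤ` is integral and `𝔐 ∩ ℤ ∋ 3` is a non-zero prime of the PID `ℤ`.
(2) *Frobenius.* Pick `𝔓 ∣ 𝔭` and an arithmetic Frobenius `τ` at `𝔓` (tree: `primesAbove_nonempty`,
`exists_isArithFrobAt_of_mem_primesAbove_holds`); then `tr ρ(τ⁻¹) = ι⁻¹(e(a_𝔭 f))` and
`charpoly ρ'(τ) = ∏_{a ∈ α} (X − ι⁻¹((N𝔭·a)⁻¹))`.  LINEAR ALGEBRA: an invertible matrix `M` over a
field with `charpoly M = ∏_{c ∈ s} (X − c)` has `charpoly M⁻¹ = ∏_{c ∈ s} (X − c⁻¹)` (Mathlib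
`Matrix.charpoly_inv`, `Matrix.reverse_charpoly`; `det M = ∏ c ≠ 0`), so `tr M⁻¹ = Σ c⁻¹` and
`tr ρ'(τ⁻¹) = ι⁻¹(N𝔭 · Σ α)`.  Hence `t := t₀ − e(a_𝔭 f) ∈ ℤ̄` has
`‖ι⁻¹ t‖ = ‖tr ρ'(τ⁻¹) − tr ρ(τ⁻¹)‖ ≤ 3^{-k} = ‖ι⁻¹ 3^k‖`.
(3) *The unit `u`* (`exists_not_mem_and_mul_mem_span`): if `t, b ∈ ℤ̄`, `b ≠ 0` and
`‖ι⁻¹ t‖ ≤ ‖ι⁻¹ b‖`, then `u t ∈ b ℤ̄` for some `u ∈ ℤ̄ ∖ 𝔐`.  In the ring of integers `O` of the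
number field `ℚ(t, b) ⊂ ℂ` put `𝔪 := 𝔐 ∩ O` and factor `(t) = 𝔪^m A`, `(b) = 𝔪^n B` with
`A, B ⊄ 𝔪` (`WfDvdMonoid.max_power_factor'` in the monoid of ideals of a Dedekind domain).  If
`n ≤ m`, any `u ∈ B ∖ 𝔪` has `u t ∈ 𝔪^n B = (b)`.  If `m < n`, any `u ∈ A ∖ 𝔪` has `u b = c t` with
`c ∈ 𝔪`, and `‖ι⁻¹ b‖ = ‖ι⁻¹ c‖‖ι⁻¹ t‖ ≤ ‖ι⁻¹ c‖‖ι⁻¹ b‖ < ‖ι⁻¹ b‖`, absurd.  This is the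
refuter's reading `u ∉ 𝔐 ∧ u·t ∈ (3^k) ⇔ v_𝔐(t) ≥ k·v_𝔐(3)` (crux Disproof §F3; NOT `t ∈ 𝔐^k`,
trap (a)).

References: Serre, *Abelian ℓ-adic representations and elliptic curves* (1968), Ch. I §2.3;
Neukirch, *Algebraic Number Theory*, Ch. I §3 (factorisation of ideals), Ch. II §8 (places of `ℚ̄`).
-/

-- `Summit.Langlands.Langlands.…` (summit = sub-problem name, D-0017 layout) trips `dupNamespace` on every decl.
set_option linter.dupNamespace false

namespace Summit.Langlands.Langlands.Cruxes.MuOrdinaryFamilyRT.CharZeroDominance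

open scoped NumberField Polynomial Matrix Classical
open Field IsDedekindDomain Polynomial
open Literature.NumberTheory.GaloisRepresentations Literature.NumberTheory.Automorphic

noncomputable section

/-! ## The registered statement (verbatim) -/

/-- `K = ℚ(ω)`. -/
abbrev K : Type := CyclotomicField 3 ℚ

/-- STUB 6 — **the dictionary to the typed `ℤ̄_𝔐`-congruence** (provable now; size M).  VERBATIM
weight-blind's Stub E: for `ι : ℚ̄₃ ≃ ℂ` put `𝔐 = {z ∈ ℤ̄ : ‖ι⁻¹ z‖ < 1}` (maximal, `∋ 3`); if `ρ` has
geometric-Frobenius trace `ι⁻¹(e(a_𝔭 f))` at `𝔭 ∤ 3`, `ρ'` has arithmetic-Frobenius characteristic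
polynomial `arithFrobPolyOfSatake ι N𝔭 3 α` at `𝔭` (so `tr ρ'(Frob_𝔭⁻¹) = ι⁻¹(N𝔭·Σ α)`),
`N𝔭·Σα = t₀ ∈ ℤ̄`, and `‖tr ρ' − tr ρ‖ ≤ 3^{-k}` on `Γ_K`, then `t = t₀ − e(a_𝔭 f) ∈ ℤ̄` has
`u·t ∈ 3^k ℤ̄` for some `u ∉ 𝔐` (`ℤ̄_𝔐` is the valuation ring of the place `ι⁻¹` on `ℚ̄`; CRT in the
number field `ℚ(t)`).  This is the refuter's reading `u ∉ 𝔐 ∧ u·t ∈ (3^k) ⇔ v_𝔐(t) ≥ k·v(3)`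
(Disproof F3; do NOT restate as `t ∈ 𝔐^k`, trap (a)). -/
def S.stub_dictionary : Prop :=
  ∀ (ι : PadicAlgCl 3 ≃+* ℂ) (e : K →+* ℂ),
  ∃ 𝔐 : Ideal (integralClosure ℤ ℂ), 𝔐.IsMaximal ∧ (3 : integralClosure ℤ ℂ) ∈ 𝔐 ∧
    ∀ (k : ℕ) (f : ℤ[X]) (ρ ρ' : FramedGaloisRep K (PadicAlgCl 3) 3)
      (𝔭 : HeightOneSpectrum (𝓞 K)) (α : Multiset ℂ) (t₀ : integralClosure ℤ ℂ),
      ((3 : ℕ) : 𝓞 K) ∉ 𝔭.asIdeal →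
      (ρ.IsUnramifiedAt 𝔭 ∧
        ∀ 𝔓 ∈ 𝔭.primesAbove, ∀ τ : absoluteGaloisGroup K,
          IsArithFrobAt (𝓞 K) τ 𝔓 → FramedRep.trace ρ τ⁻¹ = ι.symm (e (picardTrace f 𝔭))) →
      ρ'.HasFrobCharpolyAt 𝔭 (arithFrobPolyOfSatake ι 𝔭.residueCard 3 α) →
      (t₀ : ℂ) = (𝔭.residueCard : ℂ) * α.sum →
      (∀ g, ‖FramedRep.trace ρ' g - FramedRep.trace ρ g‖ ≤ ((3 : ℝ)⁻¹) ^ k) →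
      ∃ (t u : integralClosure ℤ ℂ),
        (t : ℂ) = (𝔭.residueCard : ℂ) * α.sum - e (picardTrace f 𝔭) ∧
        u ∉ 𝔐 ∧ u * t ∈ Ideal.span {(3 : integralClosure ℤ ℂ) ^ k}

/-! ## 1. Norms of algebraic integers in `ℚ̄₃` -/

variable (ι : PadicAlgCl 3 ≃+* ℂ)

/-- Algebraic integers `z ∈ ℤ̄ ⊂ ℂ` have `‖ι⁻¹ z‖ ≤ 1`: `ι⁻¹ z ∈ ℚ̄₃` is integral over `ℤ`, and the
closed unit ball of `ℚ̄₃` is a valuation ring, hence integrally closed (tree: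
`PadicAlgCl.norm_le_one_of_isIntegral`, Mathlib `Valuation.Integers.isIntegral_iff_v_le_one`). -/
theorem norm_iotaInv_le_one (z : integralClosure ℤ ℂ) : ‖ι.symm (z : ℂ)‖ ≤ 1 :=
  PadicAlgCl.norm_le_one_of_isIntegral 3 (map_isIntegral_int ι.symm z.2)

/-- `‖ι⁻¹ 3^k‖ = 3^{-k}` (the norm of `ℚ̄₃` extends the `3`-adic norm: `‖3‖ = 3⁻¹`). -/
theorem norm_iotaInv_three_pow (k : ℕ) :
    ‖ι.symm (((3 : integralClosure ℤ ℂ) ^ k : integralClosure ℤ ℂ) : ℂ)‖ = ((3 : ℝ)⁻¹) ^ k := by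
  have h3 : ‖(3 : PadicAlgCl 3)‖ = (3 : ℝ)⁻¹ := by
    have h := PadicAlgCl.norm_extends (p := 3) 3
    rw [map_ofNat] at h
    simpa [h] using Padic.norm_p (p := 3)
  have e : (((3 : integralClosure ℤ ℂ) ^ k : integralClosure ℤ ℂ) : ℂ) = (3 : ℂ) ^ k := by
    rw [Subalgebra.coe_pow]; rfl
  rw [e, map_pow, map_ofNat, norm_pow, h3]

/-! ## 2. The place ideal `𝔐 = {z ∈ ℤ̄ : ‖ι⁻¹ z‖ < 1}` -/

/-- **The place ideal** of `ι`: `𝔐 = {z ∈ ℤ̄ : ‖ι⁻¹ z‖ < 1}`, the centre on `ℤ̄` of the place of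
`ℚ̄ ⊂ ℂ` induced by `ι⁻¹ : ℂ ≃ ℚ̄₃` (an ideal by the ultrametric inequality and §1). -/
def placeIdeal : Ideal (integralClosure ℤ ℂ) where
  carrier := {z | ‖ι.symm (z : ℂ)‖ < 1}
  add_mem' {a b} ha hb := by
    simp only [Set.mem_setOf_eq, Subalgebra.coe_add, map_add] at *
    exact lt_of_le_of_lt (PadicAlgCl.isNonarchimedean 3 _ _) (max_lt ha hb)
  zero_mem' := by simp
  smul_mem' c {x} hx := by
    simp only [Set.mem_setOf_eq, smul_eq_mul, Subalgebra.coe_mul, map_mul, norm_mul] at *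
    exact lt_of_le_of_lt (mul_le_of_le_one_left (norm_nonneg _) (norm_iotaInv_le_one ι c)) hx

/-- Membership in the place ideal. -/
@[simp] theorem mem_placeIdeal {z : integralClosure ℤ ℂ} :
    z ∈ placeIdeal ι ↔ ‖ι.symm (z : ℂ)‖ < 1 := Iff.rfl

/-- Off the place ideal the norm is exactly `1`. -/
theorem norm_eq_one_of_not_mem {z : integralClosure ℤ ℂ} (hz : z ∉ placeIdeal ι) :
    ‖ι.symm (z : ℂ)‖ = 1 :=
  le_antisymm (norm_iotaInv_le_one ι z) (not_lt.mp (mt (mem_placeIdeal ι).mpr hz))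

/-- `3 ∈ 𝔐`. -/
theorem three_mem_placeIdeal : (3 : integralClosure ℤ ℂ) ∈ placeIdeal ι := by
  rw [mem_placeIdeal, ← pow_one (3 : integralClosure ℤ ℂ), norm_iotaInv_three_pow]
  norm_num

/-- `𝔐` is prime (the norm is multiplicative and `≤ 1` on `ℤ̄`; `‖ι⁻¹ 1‖ = 1`). -/
theorem placeIdeal_isPrime : (placeIdeal ι).IsPrime := by
  refine ⟨by rw [Ideal.ne_top_iff_one]; simp, fun {a b} hab => ?_⟩
  by_contra h
  rw [mem_placeIdeal, Subalgebra.coe_mul, map_mul, norm_mul,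
    norm_eq_one_of_not_mem ι (fun ha => h (Or.inl ha)),
    norm_eq_one_of_not_mem ι (fun hb => h (Or.inr hb)), mul_one] at hab
  exact lt_irrefl _ hab

/-- **`𝔐` is maximal**: `ℤ̄` is integral over `ℤ` and `𝔐 ∩ ℤ` is a non-zero (it contains `3`)
prime ideal of the PID `ℤ`, hence maximal (`Ideal.isMaximal_of_isIntegral_of_isMaximal_comap`). -/
theorem placeIdeal_isMaximal : (placeIdeal ι).IsMaximal := by
  haveI := placeIdeal_isPrime ι
  refine Ideal.isMaximal_of_isIntegral_of_isMaximal_comap (R := ℤ) (placeIdeal ι) ?_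
  haveI hp : ((placeIdeal ι).comap (algebraMap ℤ (integralClosure ℤ ℂ))).IsPrime :=
    Ideal.comap_isPrime _ _
  refine IsPrime.to_maximal_ideal fun h0 => ?_
  have h3 : (3 : ℤ) ∈ (placeIdeal ι).comap (algebraMap ℤ (integralClosure ℤ ℂ)) := by
    rw [Ideal.mem_comap, map_ofNat]
    exact three_mem_placeIdeal ι
  rw [h0, Ideal.mem_bot] at h3
  norm_num at h3

/-! ## 3. Linear algebra: the characteristic polynomial and the trace of an inverse matrix -/

/-- `reverse` is multiplicative on multiset products (over a field). -/
theorem reverse_multiset_prod {F : Type*} [Field F] (s : Multiset F[X]) :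
    s.prod.reverse = (s.map reverse).prod := by
  induction s using Multiset.induction_on with
  | empty => simpa using reverse_C (1 : F)
  | cons a s ih => simp [reverse_mul_of_domain, ih]

/-- `reverse (X - c) = 1 - c X`. -/
theorem reverse_X_sub_C {F : Type*} [Field F] (c : F) :
    (X - C c : F[X]).reverse = 1 - C c * X := by
  rw [sub_eq_add_neg, ← C_neg, reverse_add_C, natDegree_X]
  have h1 : (1 : F[X]).reverse = 1 := by simpa using reverse_C (1 : F)
  have : (X : F[X]).reverse = 1 := by simpa [h1] using reverse_mul_X (1 : F[X])
  rw [this, C_neg]; ring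

/-- **Characteristic polynomial of the inverse.**  If an invertible matrix `M` over a field has
`charpoly M = ∏_{c ∈ s} (X - c)`, then `charpoly M⁻¹ = ∏_{c ∈ s} (X - c⁻¹)`.  From Mathlib's
`Matrix.charpoly_inv` (`charpoly M⁻¹ = (-1)ⁿ (det M)⁻¹ · reverse (charpoly M)`),
`reverse (X - c) = -c (X - c⁻¹)` for `c ≠ 0`, and `det M = ∏ c` (so no `c` vanishes). -/
theorem charpoly_inv_of_charpoly_eq_prod {F : Type*} [Field F] {n : Type*} [Fintype n]
    [DecidableEq n] {M : Matrix n n F} (hM : IsUnit M) {s : Multiset F}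
    (h : M.charpoly = (s.map fun c => X - C c).prod) :
    M⁻¹.charpoly = (s.map fun c => X - C c⁻¹).prod := by
  have hcard : Multiset.card s = Fintype.card n := by
    have := congrArg natDegree h
    rwa [Matrix.charpoly_natDegree_eq_dim, natDegree_multiset_prod_X_sub_C_eq_card, eq_comm] at this
  have hdet : M.det = s.prod := by
    rw [Matrix.det_eq_sign_charpoly_coeff, h, coeff_zero_eq_eval_zero, eval_multiset_prod,
      Multiset.map_map]
    simp only [Function.comp_def, eval_sub, eval_X, eval_C, zero_sub]
    rw [Multiset.prod_map_neg, hcard, ← mul_assoc, ← pow_add, ← two_mul, pow_mul]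
    simp
  have hdet0 : M.det ≠ 0 := ((Matrix.isUnit_iff_isUnit_det M).mp hM).ne_zero
  have hs0 : ∀ c ∈ s, c ≠ 0 := fun c hc h0 => hdet0 (hdet ▸ Multiset.prod_eq_zero (h0 ▸ hc))
  rw [Matrix.charpoly_inv M hM, ← Matrix.reverse_charpoly, h, reverse_multiset_prod,
    Multiset.map_map]
  have h1 : (s.map (reverse ∘ fun c => X - C c)) = s.map (fun c => C (-c) * (X - C c⁻¹)) := by
    refine Multiset.map_congr rfl fun c hc => ?_
    simp only [Function.comp_def, reverse_X_sub_C]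
    rw [C_neg, neg_mul, mul_sub, ← C_mul, mul_inv_cancel₀ (hs0 c hc), C_1]
    ring
  have h2 : (s.map fun c => C (-c)).prod = C ((-1) ^ Fintype.card n * s.prod) := by
    rw [← hcard, ← Multiset.prod_map_neg, map_multiset_prod, Multiset.map_map]
    rfl
  have h3 : ((-1 : F[X]) ^ Fintype.card n * C (s.prod)⁻¹ * C ((-1) ^ Fintype.card n * s.prod)) =
      1 := by
    rw [← C_1, ← C_neg, ← C_pow, ← C_mul, ← C_mul]
    congr 1
    rw [mul_comm ((-1 : F) ^ _) s.prod, ← mul_assoc, mul_assoc _ _ s.prod,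
      inv_mul_cancel₀ (hdet ▸ hdet0), mul_one, ← pow_add, ← two_mul, pow_mul]
    simp
  rw [h1, Multiset.prod_map_mul, Ring.inverse_eq_inv', hdet, h2, ← mul_assoc, h3, one_mul]

/-- **Trace of the inverse.**  If an invertible matrix `M` over a field has
`charpoly M = ∏_{c ∈ s} (X - c)`, then `tr M⁻¹ = Σ_{c ∈ s} c⁻¹` (the trace is minus the
next-to-leading coefficient of the characteristic polynomial). -/
theorem trace_inv_of_charpoly_eq_prod {F : Type*} [Field F] {n : Type*} [Fintype n]
    [DecidableEq n] {M : Matrix n n F} (hM : IsUnit M) {s : Multiset F}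
    (h : M.charpoly = (s.map fun c => X - C c).prod) :
    M⁻¹.trace = (s.map fun c => c⁻¹).sum := by
  rw [Matrix.trace_eq_neg_charpoly_nextCoeff, charpoly_inv_of_charpoly_eq_prod hM h]
  have : (s.map fun c => X - C c⁻¹) = ((s.map fun c => c⁻¹).map fun c => X - C c) := by
    rw [Multiset.map_map]; rfl
  rw [this, multiset_prod_X_sub_C_nextCoeff, neg_neg]

/-! ## 4. The number-field step: `v_𝔐(t) ≥ v_𝔐(b)` gives `u · t ∈ (b)` with `u ∉ 𝔐` -/

/-- **Dichotomy in a Dedekind domain.**  For a prime `𝔪` and non-zero `a, b`: either `u a ∈ (b)`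
for some `u ∉ 𝔪` (the case `v_𝔪(a) ≥ v_𝔪(b)`), or `u b = c a` for some `u ∉ 𝔪` and `c ∈ 𝔪` (the
case `v_𝔪(a) < v_𝔪(b)`).  Proof: factor `(a) = 𝔪^m A`, `(b) = 𝔪^n B` with `A, B ⊄ 𝔪`
(`WfDvdMonoid.max_power_factor'` in the monoid of ideals), then pick `u ∈ B ∖ 𝔪`, resp.
`u ∈ A ∖ 𝔪`. -/
theorem dedekind_dichotomy {O : Type*} [CommRing O] [IsDedekindDomain O] {𝔪 : Ideal O}
    (h𝔪 : 𝔪.IsPrime) {a b : O} (ha : a ≠ 0) (hb : b ≠ 0) :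
    (∃ u ∉ 𝔪, ∃ c, u * a = c * b) ∨ (∃ u ∉ 𝔪, ∃ c ∈ 𝔪, u * b = c * a) := by
  have hunit : ¬ IsUnit 𝔪 := fun h => h𝔪.ne_top (Ideal.isUnit_iff.mp h)
  obtain ⟨m, A, hA, hfa⟩ := WfDvdMonoid.max_power_factor' (a₀ := Ideal.span {a})
    (by simpa [Ideal.span_singleton_eq_bot] using ha) hunit
  obtain ⟨n, B, hB, hfb⟩ := WfDvdMonoid.max_power_factor' (a₀ := Ideal.span {b})
    (by simpa [Ideal.span_singleton_eq_bot] using hb) hunit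
  rw [Ideal.dvd_iff_le] at hA hB
  obtain ⟨uA, huA, huA𝔪⟩ := SetLike.not_le_iff_exists.mp hA
  obtain ⟨uB, huB, huB𝔪⟩ := SetLike.not_le_iff_exists.mp hB
  rcases le_or_gt n m with hnm | hmn
  · have h2 : B * Ideal.span {a} ≤ Ideal.span {b} := by
      rw [hfa, hfb]
      calc B * (𝔪 ^ m * A) ≤ B * 𝔪 ^ m := Ideal.mul_mono_right Ideal.mul_le_right
        _ ≤ B * 𝔪 ^ n := Ideal.mul_mono_right (Ideal.pow_le_pow_right hnm)
        _ = 𝔪 ^ n * B := mul_comm _ _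
    obtain ⟨c, hc⟩ := Ideal.mem_span_singleton'.mp
      (h2 (Ideal.mul_mem_mul huB (Ideal.mem_span_singleton_self a)))
    exact Or.inl ⟨uB, huB𝔪, c, hc.symm⟩
  · have h2 : A * Ideal.span {b} ≤ 𝔪 * Ideal.span {a} := by
      rw [hfa, hfb]
      calc A * (𝔪 ^ n * B) ≤ A * 𝔪 ^ n := Ideal.mul_mono_right Ideal.mul_le_right
        _ ≤ A * 𝔪 ^ (m + 1) := Ideal.mul_mono_right (Ideal.pow_le_pow_right hmn)
        _ = 𝔪 * (𝔪 ^ m * A) := by ring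
    obtain ⟨c, hc, hca⟩ := Ideal.mem_mul_span_singleton.mp
      (h2 (Ideal.mul_mem_mul huA (Ideal.mem_span_singleton_self b)))
    exact Or.inr ⟨uA, huA𝔪, c, hc, hca.symm⟩

/-- **The number-field step.**  If `t, b ∈ ℤ̄`, `b ≠ 0` and `‖ι⁻¹ t‖ ≤ ‖ι⁻¹ b‖`, then `u · t ∈ b ℤ̄`
for some `u ∈ ℤ̄ ∖ 𝔐` — i.e. `t / b` lies in the local ring `ℤ̄_𝔐`, the valuation ring of the place
`ι⁻¹`.  Proof in the ring of integers `O` of the number field `ℚ(t, b) ⊂ ℂ` with `𝔪 = 𝔐 ∩ O`: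
by `dedekind_dichotomy` either we are done (map `u, c` into `ℤ̄`), or `u b = c t` with `u ∉ 𝔪`,
`c ∈ 𝔪`, whence `‖ι⁻¹ b‖ = ‖ι⁻¹ c‖ ‖ι⁻¹ t‖ ≤ ‖ι⁻¹ c‖ ‖ι⁻¹ b‖ < ‖ι⁻¹ b‖`, absurd. -/
theorem exists_not_mem_and_mul_mem_span {t b : integralClosure ℤ ℂ} (hb : (b : ℂ) ≠ 0)
    (htb : ‖ι.symm (t : ℂ)‖ ≤ ‖ι.symm (b : ℂ)‖) :
    ∃ u, u ∉ placeIdeal ι ∧ u * t ∈ Ideal.span {b} := by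
  classical
  by_cases ht : t = 0
  · exact ⟨1, by simp, by simp [ht]⟩
  have htI : IsIntegral ℤ (t : ℂ) := t.2
  have hbI : IsIntegral ℤ (b : ℂ) := b.2
  -- the number field `ℚ(t, b) ⊂ ℂ`, its ring of integers `O ∋ t, b`, and `ψ : O → ℤ̄`
  let Fld : IntermediateField ℚ ℂ := IntermediateField.adjoin ℚ {(t : ℂ), (b : ℂ)}
  haveI : FiniteDimensional ℚ Fld := IntermediateField.finiteDimensional_adjoin (fun x hx => by
    rcases hx with rfl | rfl
    · exact htI.tower_top
    · exact hbI.tower_top)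
  haveI : NumberField Fld := NumberField.of_module_finite ℚ Fld
  have htF : (t : ℂ) ∈ Fld := IntermediateField.subset_adjoin ℚ _ (by simp)
  have hbF : (b : ℂ) ∈ Fld := IntermediateField.subset_adjoin ℚ _ (by simp)
  have hinj : Function.Injective (algebraMap Fld ℂ) := (algebraMap Fld ℂ).injective
  let tO : 𝓞 Fld := ⟨⟨(t : ℂ), htF⟩, (isIntegral_algebraMap_iff hinj).mp htI⟩
  let bO : 𝓞 Fld := ⟨⟨(b : ℂ), hbF⟩, (isIntegral_algebraMap_iff hinj).mp hbI⟩
  let j : 𝓞 Fld →+* ℂ := (algebraMap Fld ℂ).comp (algebraMap (𝓞 Fld) Fld)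
  let ψ : 𝓞 Fld →+* integralClosure ℤ ℂ := j.codRestrict (integralClosure ℤ ℂ)
    fun x => map_isIntegral_int j (NumberField.RingOfIntegers.isIntegral x)
  have hψt : ψ tO = t := Subtype.ext rfl
  have hψb : ψ bO = b := Subtype.ext rfl
  have htO0 : tO ≠ 0 := fun h0 => ht (by rw [← hψt, h0, map_zero])
  have hbO0 : bO ≠ 0 := fun h0 => hb (by rw [← hψb, h0, map_zero]; rfl)
  -- the prime `𝔪 = 𝔐 ∩ O` and the dichotomy
  haveI := placeIdeal_isPrime ι
  rcases dedekind_dichotomy (Ideal.comap_isPrime ψ (placeIdeal ι)) htO0 hbO0 with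
    ⟨u, hu, c, huc⟩ | ⟨u, hu, c, hc, huc⟩
  · refine ⟨ψ u, hu, ?_⟩
    rw [← hψt, ← map_mul, huc, map_mul, hψb]
    exact Ideal.mul_mem_left _ _ (Ideal.mem_span_singleton_self b)
  · exfalso
    have hc1 : ‖ι.symm ((ψ c : integralClosure ℤ ℂ) : ℂ)‖ < 1 := hc
    have hb0 : 0 < ‖ι.symm (b : ℂ)‖ := norm_pos_iff.mpr fun h0 => hb (by simpa using congrArg ι h0)
    have key := congrArg (fun x : 𝓞 Fld => ‖ι.symm ((ψ x : integralClosure ℤ ℂ) : ℂ)‖) huc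
    simp only [map_mul, Subalgebra.coe_mul, norm_mul, norm_eq_one_of_not_mem ι hu, one_mul, hψt,
      hψb] at key
    have : ‖ι.symm (b : ℂ)‖ < ‖ι.symm (b : ℂ)‖ :=
      calc ‖ι.symm (b : ℂ)‖ = ‖ι.symm ((ψ c : integralClosure ℤ ℂ) : ℂ)‖ * ‖ι.symm (t : ℂ)‖ := key
        _ ≤ ‖ι.symm ((ψ c : integralClosure ℤ ℂ) : ℂ)‖ * ‖ι.symm (b : ℂ)‖ :=
          mul_le_mul_of_nonneg_left htb (norm_nonneg _)
        _ < 1 * ‖ι.symm (b : ℂ)‖ := mul_lt_mul_of_pos_right hc1 hb0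
        _ = ‖ι.symm (b : ℂ)‖ := one_mul _
    exact lt_irrefl _ this

/-! ## 5. Frobenius bookkeeping -/

/-- **Trace of the inverse Frobenius from the Satake polynomial.**  If the invertible `3 × 3` matrix
`M` over `ℚ̄₃` has characteristic polynomial `arithFrobPolyOfSatake ι q 3 α =
∏_{a ∈ α} (X − ι⁻¹(((√q)² a)⁻¹))`, then `tr M⁻¹ = ι⁻¹(q · Σ α)`. -/
theorem trace_inv_of_charpoly_eq_arithFrobPolyOfSatake (q : ℕ) (α : Multiset ℂ)
    (M : GL (Fin 3) (PadicAlgCl 3))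
    (h : (M : Matrix (Fin 3) (Fin 3) (PadicAlgCl 3)).charpoly = arithFrobPolyOfSatake ι q 3 α) :
    ((M⁻¹ : GL (Fin 3) (PadicAlgCl 3)) : Matrix (Fin 3) (Fin 3) (PadicAlgCl 3)).trace =
      ι.symm ((q : ℂ) * α.sum) := by
  have hsqrt : ((Real.sqrt q : ℝ) : ℂ) ^ (3 - 1) = (q : ℂ) := by
    rw [show (3 - 1 : ℕ) = 2 from rfl, ← Complex.ofReal_pow, Real.sq_sqrt (Nat.cast_nonneg q),
      Complex.ofReal_natCast]
  have h' : (M : Matrix (Fin 3) (Fin 3) (PadicAlgCl 3)).charpoly =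
      ((α.map fun a => ι.symm ((q : ℂ) * a)⁻¹).map fun c => X - C c).prod := by
    rw [h, arithFrobPolyOfSatake, Multiset.map_map]
    refine congrArg _ (Multiset.map_congr rfl fun a _ => ?_)
    simp only [Function.comp_apply, hsqrt]
  rw [Matrix.coe_units_inv, trace_inv_of_charpoly_eq_prod (Units.isUnit M) h', Multiset.map_map]
  have e1 : ((fun c : PadicAlgCl 3 => c⁻¹) ∘ fun a : ℂ => ι.symm ((q : ℂ) * a)⁻¹) =
      fun a => ι.symm ((q : ℂ) * a) := by
    funext a
    simp only [Function.comp_apply, map_inv₀, inv_inv]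
  rw [e1]
  calc (α.map fun a => ι.symm ((q : ℂ) * a)).sum
      = ι.symm ((α.map fun a => (q : ℂ) * a).sum) := by
        rw [map_multiset_sum, Multiset.map_map]; rfl
    _ = ι.symm ((q : ℂ) * α.sum) := by rw [Multiset.sum_map_mul_left, Multiset.map_id']

/-! ## The registered stub -/

/-- **STUB 6 of the line `char-zero-dominance` (`stub_dictionary`, registered signature verbatim):
the dictionary from `3`-adic proximity of traces to the typed `ℤ̄_𝔐`-congruence.**  With
`𝔐 = placeIdeal ι = {z ∈ ℤ̄ : ‖ι⁻¹ z‖ < 1}` (maximal, `∋ 3`): an arithmetic Frobenius `τ` at a prime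
`𝔓 ∣ 𝔭` exists; `tr ρ(τ⁻¹) = ι⁻¹(e(a_𝔭 f))` by hypothesis and `tr ρ'(τ⁻¹) = ι⁻¹(N𝔭 · Σ α)` by
`trace_inv_of_charpoly_eq_arithFrobPolyOfSatake`; so `t := t₀ − e(a_𝔭 f) ∈ ℤ̄` has
`‖ι⁻¹ t‖ = ‖tr ρ'(τ⁻¹) − tr ρ(τ⁻¹)‖ ≤ 3^{-k} = ‖ι⁻¹ 3^k‖`, and `exists_not_mem_and_mul_mem_span`
gives `u ∉ 𝔐` with `u · t ∈ (3^k)`. -/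
theorem stub_dictionary : S.stub_dictionary := by
  intro ι e
  refine ⟨placeIdeal ι, placeIdeal_isMaximal ι, three_mem_placeIdeal ι, ?_⟩
  intro k f ρ ρ' 𝔭 α t₀ _ hρ hρ' ht₀ happrox
  -- an arithmetic Frobenius `τ` at a prime `𝔓 ∣ 𝔭`, and the two traces at `τ⁻¹`
  obtain ⟨𝔓, h𝔓⟩ := HeightOneSpectrum.primesAbove_nonempty 𝔭
  obtain ⟨τ, hτ⟩ := HeightOneSpectrum.exists_isArithFrobAt_of_mem_primesAbove_holds h𝔓
  have htr : FramedRep.trace ρ τ⁻¹ = ι.symm (e (picardTrace f 𝔭)) := hρ.2 𝔓 h𝔓 τ hτ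
  have htr' : FramedRep.trace ρ' τ⁻¹ = ι.symm ((𝔭.residueCard : ℂ) * α.sum) := by
    unfold FramedRep.trace
    rw [map_inv]
    exact trace_inv_of_charpoly_eq_arithFrobPolyOfSatake ι 𝔭.residueCard α (ρ' τ) (hρ' 𝔓 h𝔓 τ hτ)
  -- the algebraic integer `t = t₀ - e(a_𝔭 f)`
  let T : integralClosure ℤ ℂ :=
    ⟨e (picardTrace f 𝔭), map_isIntegral_int e (NumberField.RingOfIntegers.isIntegral_coe _)⟩
  have htcoe : ((t₀ - T : integralClosure ℤ ℂ) : ℂ) =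
      (𝔭.residueCard : ℂ) * α.sum - e (picardTrace f 𝔭) := by
    rw [Subalgebra.coe_sub, ht₀]
  -- `‖ι⁻¹ t‖ = ‖tr ρ'(τ⁻¹) - tr ρ(τ⁻¹)‖ ≤ 3^{-k} = ‖ι⁻¹ 3^k‖`
  have hnorm : ‖ι.symm ((t₀ - T : integralClosure ℤ ℂ) : ℂ)‖ ≤
      ‖ι.symm (((3 : integralClosure ℤ ℂ) ^ k : integralClosure ℤ ℂ) : ℂ)‖ := by
    have e1 : ι.symm ((t₀ - T : integralClosure ℤ ℂ) : ℂ) =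
        FramedRep.trace ρ' τ⁻¹ - FramedRep.trace ρ τ⁻¹ := by
      rw [htr', htr, ← map_sub, htcoe]
    rw [e1, norm_iotaInv_three_pow]
    exact happrox τ⁻¹
  have h3k : (((3 : integralClosure ℤ ℂ) ^ k : integralClosure ℤ ℂ) : ℂ) ≠ 0 := by
    rw [Subalgebra.coe_pow]
    exact pow_ne_zero k (by norm_num)
  obtain ⟨u, hu, hut⟩ := exists_not_mem_and_mul_mem_span ι h3k hnorm
  exact ⟨t₀ - T, u, htcoe, hu, hut⟩

end

end Summit.Langlands.Langlands.Cruxes.MuOrdinaryFamilyRT.CharZeroDominance
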